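import Mathlib
import HarnessLib
import Summits.Schanuel.Statement
import Summits.Schanuel.Schanuel.Theses.TwistedConjugacy

/-!
# Birth skeleton — crux `TwistedSymmetry` (stmt-Schanuel-17222), route `TwistedConjugacy`

Line `birth` (skeleton registrar, BC3).  The crux says: for one algebraic `μ` with `‖μ‖ = 1`, not a
root of unity, there is a ring endomorphism `σ` of `ℂ` fixing every algebraic number with
`σ (exp z) = exp (μ • σ z)`.

THE CUT.  Let `C ⊆ ℂ` be the FORCED CORE: the smallest subfield containing every algebraic number
and every logarithm of an algebraic number (`exp w ∈ ℚ̄ ⇒ w ∈ C`; so `2πi, log 2, … ∈ C`) and closed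
under `exp` (so `e, e^e, e^{log 2 · log 3}, e^π, … ∈ C`).  `C` is countable, and on `C` a twisted
`ℚ̄`-fixing embedding is UNIQUE if it exists: a twisted `σ` is forced to be `ℓ ↦ μ⁻¹ ℓ` on logarithms
of algebraic numbers (divisibility of the kernel ambiguity by every `N`) and is then propagated by
`σ (exp z) = exp (μ σ z)`; the equaliser of two twisted embeddings is an `exp`-closed subfield
containing `ℚ̄ ∪ 𝓛`, hence all of `C`.

* `stub_coreTwist` — the ARITHMETIC half: a twisted `ℚ̄`-fixing embedding `σ₀ : C →+* ℂ` exists for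
  some admissible `μ`.  Because `σ₀` is forced, this is a pure consistency statement: "replacing
  `exp` by `exp ∘ (μ •)` and every `ℓ ∈ 𝓛` by `ℓ/μ` respects every algebraic relation over `ℚ̄`
  among iterated exponentials of algebraic numbers and their logarithms".  It already carries every
  Diophantine deliverable of the route (e ⊥ π, log-homogeneity, two logarithms, Schanuel on the
  sector E ⊕ ℚ·2πi), since those arguments only evaluate `σ` on elements of `C` and `σ₀ (C) ⊆ C`.
  It is implied by Schanuel's conjecture (SC makes `C` the free exponential closure of the log-base,
  and SC is invariant under `exp ↦ exp ∘ (μ •)` for algebraic `μ`), which `TwistedSymmetry` itself is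
  not known to be.
* `stub_coreTwistExtends` — the TRANS-ARITHMETIC half: the (unique) twisted embedding of the core
  extends to a twisted `ℚ̄`-fixing ring endomorphism of `ℂ`.  This isolates exactly the part of the
  crux that exceeds Schanuel: the wild extension across the uncountable remainder (Zilber-categoricity
  strength: both `(ℂ, exp)` and `(ℂ, exp ∘ (μ •))` should be the canonical Zilber field, and the core
  is strong in both under SC).

`TwistedSymmetry_of` (§3) is the crux BY NAME modulo exactly the two stubs; §2 shows the curried composition
`stub₁-sig → stub₂-sig → TwistedSymmetry` sorry-free (a modus-ponens seam; the content sits in the two stubs,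
neither of which gives the crux or `Schanuel` on its own — BC3 probes `stub → crux`, `stub → Schanuel` by
`exact? | simpa | unfold; simpa | aesop` all FAIL, recorded in `Lines/birth.md`).
-/

-- `Summit.<Summit>.<Problem>`: for the single-conjunct summit the duplicate `Schanuel.Schanuel` is mandated.
set_option linter.dupNamespace false

namespace Summit.Schanuel.Schanuel.Cruxes.TwistedSymmetry.Birth

open Summit.Schanuel.Schanuel.Theses.TwistedConjugacy

/-! ## §1 The two registered stubs (`sorry` lives ONLY here; signatures self-contained over Mathlib) -/

/-- STUB (arithmetic core, forced).  For some algebraic `μ` on the unit circle, not a root of unity,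
the forced core `C` (smallest subfield of `ℂ` containing `ℚ̄` and all logarithms of algebraic
numbers and closed under `exp`) admits a ring embedding `σ₀ : C →+* ℂ` fixing every algebraic number
and twisted: `σ₀ (exp z) = exp (μ σ₀ z)` for `z ∈ C`.  (`C` is bound as `E` by the defining
equation to keep the signature self-contained.) -/
theorem stub_coreTwist :
    ∃ μ : ℂ, IsAlgebraic ℚ μ ∧ ‖μ‖ = 1 ∧ (∀ n : ℕ, 0 < n → μ ^ n ≠ 1) ∧
      ∀ E : IntermediateField ℚ ℂ,
        E = sInf {K : IntermediateField ℚ ℂ | algebraicClosure ℚ ℂ ≤ K ∧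
              (∀ w : ℂ, IsAlgebraic ℚ (Complex.exp w) → w ∈ K) ∧ ∀ w ∈ K, Complex.exp w ∈ K} →
        ∃ σ₀ : E →+* ℂ, (∀ a : E, IsAlgebraic ℚ (a : ℂ) → σ₀ a = (a : ℂ)) ∧
          ∀ (z : E) (hz : Complex.exp (z : ℂ) ∈ E),
            σ₀ ⟨Complex.exp (z : ℂ), hz⟩ = Complex.exp (μ * σ₀ z) := by
  sorry

/-- STUB (extension from the forced core).  For every admissible `μ` and every twisted
`ℚ̄`-fixing embedding `σ₀` of the forced core `C` into `ℂ`, there is a ring endomorphism `σ` of `ℂ`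
fixing every algebraic number, twisted (`σ (exp z) = exp (μ σ z)` for all `z`), and extending `σ₀`. -/
theorem stub_coreTwistExtends :
    ∀ μ : ℂ, IsAlgebraic ℚ μ → ‖μ‖ = 1 → (∀ n : ℕ, 0 < n → μ ^ n ≠ 1) →
      ∀ E : IntermediateField ℚ ℂ,
        E = sInf {K : IntermediateField ℚ ℂ | algebraicClosure ℚ ℂ ≤ K ∧
              (∀ w : ℂ, IsAlgebraic ℚ (Complex.exp w) → w ∈ K) ∧ ∀ w ∈ K, Complex.exp w ∈ K} →
        ∀ σ₀ : E →+* ℂ, (∀ a : E, IsAlgebraic ℚ (a : ℂ) → σ₀ a = (a : ℂ)) →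
          (∀ (z : E) (hz : Complex.exp (z : ℂ) ∈ E),
              σ₀ ⟨Complex.exp (z : ℂ), hz⟩ = Complex.exp (μ * σ₀ z)) →
          ∃ σ : ℂ →+* ℂ, (∀ a : ℂ, IsAlgebraic ℚ a → σ a = a) ∧
            (∀ z : ℂ, σ (Complex.exp z) = Complex.exp (μ * σ z)) ∧
            ∀ x : E, σ (x : ℂ) = σ₀ x := by
  sorry

/-! ## §2 The composition (sorry-free): `stub₁-sig → stub₂-sig → crux`

Written as an `example` so that exactly ONE named theorem of this file concludes the crux (§3, the registered
skeleton theorem `TwistedSymmetry_of`, hypothesis-free as `#h21_check_skeleton` requires); the `example` is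
elaborated and kernel-checked like a theorem and carries no `sorry` in its closure. -/

/-- ASSEMBLY, curried BC3 shape (kernel-checked, no sorry anywhere in its closure): the two stub SIGNATURES,
verbatim, imply the crux BY NAME. The seam is modus ponens; the content sits in the stubs. -/
example :
    (∃ μ : ℂ, IsAlgebraic ℚ μ ∧ ‖μ‖ = 1 ∧ (∀ n : ℕ, 0 < n → μ ^ n ≠ 1) ∧
      ∀ E : IntermediateField ℚ ℂ,
        E = sInf {K : IntermediateField ℚ ℂ | algebraicClosure ℚ ℂ ≤ K ∧
              (∀ w : ℂ, IsAlgebraic ℚ (Complex.exp w) → w ∈ K) ∧ ∀ w ∈ K, Complex.exp w ∈ K} →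
        ∃ σ₀ : E →+* ℂ, (∀ a : E, IsAlgebraic ℚ (a : ℂ) → σ₀ a = (a : ℂ)) ∧
          ∀ (z : E) (hz : Complex.exp (z : ℂ) ∈ E),
            σ₀ ⟨Complex.exp (z : ℂ), hz⟩ = Complex.exp (μ * σ₀ z)) →
    (∀ μ : ℂ, IsAlgebraic ℚ μ → ‖μ‖ = 1 → (∀ n : ℕ, 0 < n → μ ^ n ≠ 1) →
      ∀ E : IntermediateField ℚ ℂ,
        E = sInf {K : IntermediateField ℚ ℂ | algebraicClosure ℚ ℂ ≤ K ∧
              (∀ w : ℂ, IsAlgebraic ℚ (Complex.exp w) → w ∈ K) ∧ ∀ w ∈ K, Complex.exp w ∈ K} →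
        ∀ σ₀ : E →+* ℂ, (∀ a : E, IsAlgebraic ℚ (a : ℂ) → σ₀ a = (a : ℂ)) →
          (∀ (z : E) (hz : Complex.exp (z : ℂ) ∈ E),
              σ₀ ⟨Complex.exp (z : ℂ), hz⟩ = Complex.exp (μ * σ₀ z)) →
          ∃ σ : ℂ →+* ℂ, (∀ a : ℂ, IsAlgebraic ℚ a → σ a = a) ∧
            (∀ z : ℂ, σ (Complex.exp z) = Complex.exp (μ * σ z)) ∧
            ∀ x : E, σ (x : ℂ) = σ₀ x) →
    Summit.Schanuel.Schanuel.Theses.TwistedConjugacy.TwistedSymmetry := by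
  intro hCore hExt
  obtain ⟨μ, hμalg, hμnorm, hμtor, hσ₀⟩ := hCore
  obtain ⟨σ₀, hfix₀, htwist₀⟩ := hσ₀ _ rfl
  obtain ⟨σ, hfix, htwist, -⟩ := hExt μ hμalg hμnorm hμtor _ rfl σ₀ hfix₀ htwist₀
  exact ⟨μ, hμalg, hμnorm, hμtor, σ, hfix, htwist⟩

/-! ## §3 The registered skeleton theorem: the crux BY NAME, modulo exactly the two declared stubs -/

/-- **THE SKELETON THEOREM** — `TwistedSymmetry` BY NAME with NO hypotheses: the §2 composition applied to the
two declared stubs `stub_coreTwist`, `stub_coreTwistExtends` (so `#print axioms` reaches `sorryAx` exactly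
through those two; it closes nothing until they land, and becomes the crux proof verbatim when they do). -/
theorem TwistedSymmetry_of :
    Summit.Schanuel.Schanuel.Theses.TwistedConjugacy.TwistedSymmetry := by
  obtain ⟨μ, hμalg, hμnorm, hμtor, hσ₀⟩ := stub_coreTwist
  obtain ⟨σ₀, hfix₀, htwist₀⟩ := hσ₀ _ rfl
  obtain ⟨σ, hfix, htwist, -⟩ := stub_coreTwistExtends μ hμalg hμnorm hμtor _ rfl σ₀ hfix₀ htwist₀
  exact ⟨μ, hμalg, hμnorm, hμtor, σ, hfix, htwist⟩

end Summit.Schanuel.Schanuel.Cruxes.TwistedSymmetry.Birth
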